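import Mathlib
import HarnessLib
import Summits.Ventures.LatticeQCDFlow.Scaling.CumulantDiagonalLimit
import Summits.Ventures.LatticeQCDFlow.Scaling.IdentityFlowAcceptanceDiagonalLimit
import Literature.Probability.LatticeModels.ForbiddenGapFirstOrder

/-!
# LatticeQCDFlow / Scaling — the TRAINING LOSSES of the tilt family: the two Kullback–Leibler
# divergences of the exponential tilt are the Bregman divergences of the cumulant generating function,
# and over `n` independent blocks they are `n×` the block losses

HONEST FRAMING: exact (Metropolis-corrected) sampling algorithms for lattice gauge theory;
figures of merit are autocorrelation/cost numbers at stated couplings and volumes; no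
continuum-physics claim.

Venture `LatticeQCDFlow` (cell pub-lqcd), topic `Scaling`; FANOUT row 3 (`s0-u1-a`, S0-B
implementation A, GEN-20).  NEW WORK of the cell, assembled on Mathlib's Kullback–Leibler divergence
`InformationTheory.klDiv`, the exponential tilt `Measure.tilted` (`llr_tilted_right`,
`log_rnDeriv_tilted_left_self`, `tilted_tilted`, `integral_tilted_mul_self`) and the cumulant
generating function API, on row 3's `Scaling/CumulantDiagonalLimit` (bounded statistics have every
exponential moment) and `Scaling/IdentityFlowAcceptanceDiagonalLimit` (the row partition function
`M(t)^n`).  NO definition is introduced; nothing is cited (the Bregman form of the divergence inside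
an exponential family is classical information geometry [folklore]; a bounded-tilt Gibbs identity
`KL(μ.tilted V ‖ μ) = ∫ V dμ_V − log ∫ e^V dμ` also serves two crux files of
`Summits/AtomisticToContinuum/HydrodynamicLimit` — not imported here (kinetic-theory closure) — and
the WILSON-MEASURE instance of the Bregman identity between two couplings is lean-2's
`TrivializingMaps/CouplingKLAnyGroup` (`toReal_klDiv_wilsonMeasure_eq_bregman`, Jeffreys identity);
the statements below are the abstract tilt-family form in the `cgf`/`deriv cgf` vocabulary of the
cell's diagonal laws, for an arbitrary block law and statistic).

## Setting and content (all `[ours]`)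

One block: a probability measure `μ`, a real statistic `X`, the tilt `μ_t = μ.tilted (t·X)` — the
target of the untrained sampler at coupling `t`; a flow perfectly trained for coupling `s` and reused
at `t` proposes from `μ_s`.  §1:
* `cgf_tilted_mul_of_integrable` — `cgf_{μ_s}(u) = cgf(s+u) − cgf(s)` (on the tree's
  `Literature.Probability.LatticeModels.ForbiddenGap.mgf_tilted_mul`, imported and reused);
* **`toReal_klDiv_tilted_mul_right`** — the REVERSE loss (the flow's training objective; both
  measures normalised) `KL(μ ‖ μ_t) = cgf(t) − t·E_μ X` (+ `_ne_top`), for `X, e^{tX} ∈ L¹(μ)`;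
* **`toReal_klDiv_tilted_mul_left`** — the FORWARD loss `KL(μ_t ‖ μ) = t·cgf′(t) − cgf(t)`
  (+ `_ne_top`), for `t` interior to the domain of `M` (unbounded statistics allowed);
* **`toReal_klDiv_tilted_mul_tilted_mul`** — TRANSFER: `KL(μ_s ‖ μ_t) = cgf(t) − cgf(s) − (t−s)·cgf′(s)`,
  the BREGMAN DIVERGENCE of `cgf` (the two previous items are its cases `s = 0` and `t = 0`;
  `tilted_mul_tilted_mul`: `(μ_s).tilted((t−s)X) = μ_t`).
§2 `n` independent blocks (`ν^{⊗n}`, `T = Σᵢ g(xᵢ)`, `g` bounded measurable): `cgf_T = n·cgf_g`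
(`cgf_pi_sum`, `deriv_cgf_pi_sum`, `integral_pi_sum`, `interior_integrableExpSet_pi_sum`), hence the
three losses of the `n`-block sampler are `n×` the block losses — **`toReal_klDiv_pi_tilted_right`**,
**`toReal_klDiv_pi_tilted_left`**, **`toReal_klDiv_pi_tilted_tilted`** — the `klDiv` form, for the
tilt family, of row 3's GEN-12 additivity `Scaling/KLVolumeLawPi`.  Sequel:
`Scaling/TiltKLDiagonalLimit` (both total losses `→ s/2` on the diagonal `t = c/√n`; the
loss–acceptance dictionary `acc → erfc(√(KL/2))`).

Reading (value-free): for the untrained sampler and for coupling transfer of a trained factorised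
flow alike, the training loss at fixed coupling grows linearly in the number of blocks, with the
block constant read off the cumulant generating function.
NOT CLAIMED: trained flows other than exact tilts; any value at the cell's `(β, L)`; nothing re-scored.
-/

noncomputable section

namespace Summit.Ventures.LatticeQCDFlow.Theory2

open MeasureTheory ProbabilityTheory InformationTheory Filter Finset Real Set
open scoped Topology NNReal ENNReal

/-! ## §1 One block: the divergences of the exponential tilt -/

section OneBlock

variable {Ω : Type*} {mΩ : MeasurableSpace Ω} {μ : Measure Ω} [IsProbabilityMeasure μ] {X : Ω → ℝ}

/-- The cumulant generating function under the tilt: `cgf_{μ_s}(u) = cgf(s + u) − cgf(s)` as soon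
as both exponential moments exist (the moment generating function identity
`M_{μ_s}(u) = M(s+u)/M(s)` is the tree's `Literature…ForbiddenGap.mgf_tilted_mul`, REUSED; its
`cgf_tilted_mul` assumes a bounded statistic). [ours] -/
theorem cgf_tilted_mul_of_integrable {s u : ℝ} (hs : Integrable (fun ω => Real.exp (s * X ω)) μ)
    (hsu : Integrable (fun ω => Real.exp ((s + u) * X ω)) μ) :
    cgf X (μ.tilted fun ω => s * X ω) u = cgf X μ (s + u) - cgf X μ s := by
  simp only [cgf]
  rw [Literature.Probability.LatticeModels.ForbiddenGap.mgf_tilted_mul,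
    Real.log_div (mgf_pos hsu).ne' (mgf_pos hs).ne']

/-- **THE REVERSE LOSS OF THE TILT**: `KL(μ ‖ μ.tilted(t·X)) = cgf(t) − t·E_μ X` — the training
objective (reverse Kullback–Leibler divergence, net of nothing: both measures are normalised) of a
sampler proposing from `μ` against the target `e^{tX}μ/M(t)`. [ours] -/
theorem toReal_klDiv_tilted_mul_right {t : ℝ} (hX : Integrable X μ)
    (ht : Integrable (fun ω => Real.exp (t * X ω)) μ) :
    (klDiv μ (μ.tilted fun ω => t * X ω)).toReal = cgf X μ t - t * μ[X] := by
  haveI : IsProbabilityMeasure (μ.tilted fun ω => t * X ω) := isProbabilityMeasure_tilted ht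
  rw [toReal_klDiv_of_measure_eq (absolutelyContinuous_tilted ht) (by simp)]
  have h1 := llr_tilted_right (μ := μ) (ν := μ) (f := fun ω => t * X ω)
    Measure.AbsolutelyContinuous.rfl ht
  have h2 := llr_self μ
  have h : llr μ (μ.tilted fun ω => t * X ω) =ᵐ[μ] fun ω => cgf X μ t - t * X ω := by
    filter_upwards [h1, h2] with ω hω h0
    rw [hω, h0, Pi.zero_apply, add_zero, cgf, mgf]
    ring
  rw [integral_congr_ae h, integral_sub (integrable_const _) (hX.const_mul t), integral_const,
    probReal_univ, one_smul, integral_const_mul]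

/-- The reverse loss of the tilt is finite. [ours] -/
theorem klDiv_tilted_mul_right_ne_top {t : ℝ} (hX : Integrable X μ)
    (ht : Integrable (fun ω => Real.exp (t * X ω)) μ) :
    klDiv μ (μ.tilted fun ω => t * X ω) ≠ ∞ :=
  klDiv_ne_top (absolutelyContinuous_tilted ht)
    (integrable_llr_tilted_right Measure.AbsolutelyContinuous.rfl (hX.const_mul t)
      ((integrable_congr (llr_self μ)).2 (integrable_zero _ _ _)) ht)

/-- **THE FORWARD LOSS OF THE TILT**: `KL(μ.tilted(t·X) ‖ μ) = t·cgf′(t) − cgf(t)` for `t` in the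
interior of the domain of the moment generating function (`cgf′(t) = E_{μ_t} X`). [ours] -/
theorem toReal_klDiv_tilted_mul_left {t : ℝ} (ht : t ∈ interior (integrableExpSet X μ)) :
    (klDiv (μ.tilted fun ω => t * X ω) μ).toReal = t * deriv (cgf X μ) t - cgf X μ t := by
  have hti : Integrable (fun ω => Real.exp (t * X ω)) μ :=
    interior_subset (s := integrableExpSet X μ) ht
  haveI : IsProbabilityMeasure (μ.tilted fun ω => t * X ω) := isProbabilityMeasure_tilted hti
  have hac : μ.tilted (fun ω => t * X ω) ≪ μ := tilted_absolutelyContinuous μ _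
  rw [toReal_klDiv_of_measure_eq hac (by simp)]
  have h : llr (μ.tilted fun ω => t * X ω) μ =ᵐ[μ.tilted fun ω => t * X ω]
      fun ω => t * X ω - Real.log (∫ ω, Real.exp (t * X ω) ∂μ) :=
    hac.ae_le (log_rnDeriv_tilted_left_self hti)
  have hXi : Integrable X (μ.tilted fun ω => t * X ω) :=
    memLp_one_iff_integrable.1 (by simpa using memLp_tilted_mul ht 1)
  rw [integral_congr_ae h, integral_sub (hXi.const_mul t) (integrable_const _), integral_const_mul,
    integral_const, probReal_univ, one_smul, integral_tilted_mul_self ht]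
  rfl

/-- The forward loss of the tilt is finite. [ours] -/
theorem klDiv_tilted_mul_left_ne_top {t : ℝ} (ht : t ∈ interior (integrableExpSet X μ)) :
    klDiv (μ.tilted fun ω => t * X ω) μ ≠ ∞ := by
  have hti : Integrable (fun ω => Real.exp (t * X ω)) μ :=
    interior_subset (s := integrableExpSet X μ) ht
  haveI : IsProbabilityMeasure (μ.tilted fun ω => t * X ω) := isProbabilityMeasure_tilted hti
  have hac : μ.tilted (fun ω => t * X ω) ≪ μ := tilted_absolutelyContinuous μ _
  have h : llr (μ.tilted fun ω => t * X ω) μ =ᵐ[μ.tilted fun ω => t * X ω]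
      fun ω => t * X ω - Real.log (∫ ω, Real.exp (t * X ω) ∂μ) :=
    hac.ae_le (log_rnDeriv_tilted_left_self hti)
  have hXi : Integrable X (μ.tilted fun ω => t * X ω) :=
    memLp_one_iff_integrable.1 (by simpa using memLp_tilted_mul ht 1)
  exact klDiv_ne_top hac ((integrable_congr h).2 ((hXi.const_mul t).sub (integrable_const _)))

omit [IsProbabilityMeasure μ] in
/-- Two tilts compose: `(μ_s).tilted((t − s)·X) = μ_t`. [ours] -/
theorem tilted_mul_tilted_mul {s : ℝ} (hs : Integrable (fun ω => Real.exp (s * X ω)) μ) (t : ℝ) :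
    (μ.tilted fun ω => s * X ω).tilted (fun ω => (t - s) * X ω) = μ.tilted fun ω => t * X ω := by
  rw [tilted_tilted hs]
  congr 1
  funext ω
  simp only [Pi.add_apply]
  ring

/-- **THE TRANSFER LOSS IS THE BREGMAN DIVERGENCE OF `cgf`**: for `s` in the interior of the domain
and `e^{tX} ∈ L¹(μ)`, `KL(μ_s ‖ μ_t) = cgf(t) − cgf(s) − (t − s)·cgf′(s)` — the reverse loss of a flow
perfectly trained at coupling `s` and reused at coupling `t`. [ours] -/
theorem toReal_klDiv_tilted_mul_tilted_mul {s t : ℝ} (hs : s ∈ interior (integrableExpSet X μ))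
    (ht : Integrable (fun ω => Real.exp (t * X ω)) μ) :
    (klDiv (μ.tilted fun ω => s * X ω) (μ.tilted fun ω => t * X ω)).toReal
      = cgf X μ t - cgf X μ s - (t - s) * deriv (cgf X μ) s := by
  have hsi : Integrable (fun ω => Real.exp (s * X ω)) μ :=
    interior_subset (s := integrableExpSet X μ) hs
  haveI : IsProbabilityMeasure (μ.tilted fun ω => s * X ω) := isProbabilityMeasure_tilted hsi
  have hXi : Integrable X (μ.tilted fun ω => s * X ω) :=
    memLp_one_iff_integrable.1 (by simpa using memLp_tilted_mul hs 1)
  have hexp : Integrable (fun ω => Real.exp ((t - s) * X ω)) (μ.tilted fun ω => s * X ω) := by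
    rw [integrable_tilted_iff hsi]
    refine ht.congr (ae_of_all _ fun ω => ?_)
    simp only [smul_eq_mul]
    rw [← Real.exp_add]
    congr 1
    ring
  have hst : Integrable (fun ω => Real.exp ((s + (t - s)) * X ω)) μ := by
    simpa [add_sub_cancel] using ht
  rw [← tilted_mul_tilted_mul hsi t, toReal_klDiv_tilted_mul_right hXi hexp,
    cgf_tilted_mul_of_integrable hsi hst, integral_tilted_mul_self hs, add_sub_cancel]

/-- The transfer loss is finite. [ours] -/
theorem klDiv_tilted_mul_tilted_mul_ne_top {s t : ℝ} (hs : s ∈ interior (integrableExpSet X μ))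
    (ht : Integrable (fun ω => Real.exp (t * X ω)) μ) :
    klDiv (μ.tilted fun ω => s * X ω) (μ.tilted fun ω => t * X ω) ≠ ∞ := by
  have hsi : Integrable (fun ω => Real.exp (s * X ω)) μ :=
    interior_subset (s := integrableExpSet X μ) hs
  haveI : IsProbabilityMeasure (μ.tilted fun ω => s * X ω) := isProbabilityMeasure_tilted hsi
  have hXi : Integrable X (μ.tilted fun ω => s * X ω) :=
    memLp_one_iff_integrable.1 (by simpa using memLp_tilted_mul hs 1)
  have hexp : Integrable (fun ω => Real.exp ((t - s) * X ω)) (μ.tilted fun ω => s * X ω) := by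
    rw [integrable_tilted_iff hsi]
    refine ht.congr (ae_of_all _ fun ω => ?_)
    simp only [smul_eq_mul]
    rw [← Real.exp_add]
    congr 1
    ring
  rw [← tilted_mul_tilted_mul hsi t]
  exact klDiv_tilted_mul_right_ne_top hXi hexp

end OneBlock

/-! ## §2 `n` independent blocks: the losses are `n×` the block losses -/

section Blocks

variable {X : Type*} {mX : MeasurableSpace X} {ν : Measure X} [IsProbabilityMeasure ν] {g : X → ℝ}

omit [IsProbabilityMeasure ν] in
/-- The row sum of a bounded block statistic is bounded: `|Σᵢ g(xᵢ)| ≤ n·K`. [ours] -/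
theorem pi_sum_mem_Icc {K : ℝ} (hK : ∀ x, |g x| ≤ K) (n : ℕ) :
    ∀ᵐ y ∂(Measure.pi fun _ : Fin n => ν), (∑ i, g (y i)) ∈ Set.Icc (-(n * K)) (n * K) := by
  refine ae_of_all _ fun y => abs_le.1 ?_
  calc |∑ i, g (y i)| ≤ ∑ i, |g (y i)| := Finset.abs_sum_le_sum_abs _ _
    _ ≤ ∑ _i : Fin n, K := Finset.sum_le_sum fun i _ => hK _
    _ = n * K := by simp

/-- **`cgf_T = n·cgf_g`** for the row sum `T = Σᵢ g(xᵢ)` of `n` i.i.d. blocks (the row partition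
function `M(t)^n` of `Scaling/IdentityFlowAcceptanceDiagonalLimit`). [ours] -/
theorem cgf_pi_sum (hgm : Measurable g) (n : ℕ) (t : ℝ) :
    cgf (fun y : Fin n → X => ∑ i, g (y i)) (Measure.pi fun _ : Fin n => ν) t = n * cgf g ν t := by
  rw [cgf, show mgf (fun y : Fin n → X => ∑ i, g (y i)) (Measure.pi fun _ : Fin n => ν) t
      = mgf g ν t ^ n from pi_integral_exp_mul_sum hgm n t, Real.log_pow, cgf]

/-- Every exponential moment of the row sum exists. [ours] -/
theorem interior_integrableExpSet_pi_sum (hgm : Measurable g) {K : ℝ} (hK : ∀ x, |g x| ≤ K) (n : ℕ) :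
    interior (integrableExpSet (fun y : Fin n → X => ∑ i, g (y i)) (Measure.pi fun _ : Fin n => ν))
      = Set.univ :=
  interior_integrableExpSet_eq_univ_of_mem_Icc
    (Finset.measurable_sum _ fun i _ => hgm.comp (measurable_pi_apply i)).aemeasurable
    (pi_sum_mem_Icc hK n)

/-- `cgf_T′ = n·cgf_g′`. [ours] -/
theorem deriv_cgf_pi_sum (hgm : Measurable g) (n : ℕ) (t : ℝ) :
    deriv (cgf (fun y : Fin n → X => ∑ i, g (y i)) (Measure.pi fun _ : Fin n => ν)) t
      = n * deriv (cgf g ν) t := by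
  have h : cgf (fun y : Fin n → X => ∑ i, g (y i)) (Measure.pi fun _ : Fin n => ν)
      = fun t => (n : ℝ) * cgf g ν t := funext fun t => cgf_pi_sum hgm n t
  rw [h, deriv_const_mul_field]

/-- `E[Σᵢ g(xᵢ)] = n·E g` (read off `cgf′(0)`). [ours] -/
theorem integral_pi_sum (hgm : Measurable g) {K : ℝ} (hK : ∀ x, |g x| ≤ K) (n : ℕ) :
    ∫ y, ∑ i, g (y i) ∂(Measure.pi fun _ : Fin n => ν) = n * ∫ x, g x ∂ν := by
  have hgb : ∀ᵐ x ∂ν, g x ∈ Set.Icc (-K) K := ae_of_all _ fun x => abs_le.1 (hK x)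
  have h0 : (0 : ℝ) ∈ interior (integrableExpSet (fun y : Fin n → X => ∑ i, g (y i))
      (Measure.pi fun _ : Fin n => ν)) := by
    rw [interior_integrableExpSet_pi_sum hgm hK n]; exact Set.mem_univ _
  have h0' : (0 : ℝ) ∈ interior (integrableExpSet g ν) := by
    rw [interior_integrableExpSet_eq_univ_of_mem_Icc hgm.aemeasurable hgb]; exact Set.mem_univ _
  have h1 := deriv_cgf_zero h0
  have h2 := deriv_cgf_zero h0'
  rw [probReal_univ, div_one] at h1 h2
  rw [← h1, deriv_cgf_pi_sum hgm n 0, h2]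

/-- **THE REVERSE LOSS OF THE `n`-BLOCK SAMPLER**: `KL(ν^{⊗n} ‖ e^{tT}ν^{⊗n}/M(t)^n) =
n·(cgf_g(t) − t·E_ν g)`. [ours] -/
theorem toReal_klDiv_pi_tilted_right (hgm : Measurable g) {K : ℝ} (hK : ∀ x, |g x| ≤ K) (n : ℕ)
    (t : ℝ) :
    (klDiv (Measure.pi fun _ : Fin n => ν)
        ((Measure.pi fun _ : Fin n => ν).tilted fun y => t * ∑ i, g (y i))).toReal
      = n * (cgf g ν t - t * ∫ x, g x ∂ν) := by
  have hTm : Measurable (fun y : Fin n → X => ∑ i, g (y i)) :=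
    Finset.measurable_sum _ fun i _ => hgm.comp (measurable_pi_apply i)
  have hTi : Integrable (fun y : Fin n → X => ∑ i, g (y i)) (Measure.pi fun _ : Fin n => ν) :=
    Integrable.of_mem_Icc _ _ hTm.aemeasurable (pi_sum_mem_Icc hK n)
  have hexp : Integrable (fun y : Fin n → X => Real.exp (t * ∑ i, g (y i)))
      (Measure.pi fun _ : Fin n => ν) :=
    integrable_exp_mul_of_mem_Icc hTm.aemeasurable (pi_sum_mem_Icc hK n)
  rw [toReal_klDiv_tilted_mul_right (X := fun y : Fin n → X => ∑ i, g (y i)) hTi hexp,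
    cgf_pi_sum hgm, integral_pi_sum hgm hK]
  ring

/-- **THE FORWARD LOSS OF THE `n`-BLOCK SAMPLER**: `KL(e^{tT}ν^{⊗n}/M(t)^n ‖ ν^{⊗n}) =
n·(t·cgf_g′(t) − cgf_g(t))`. [ours] -/
theorem toReal_klDiv_pi_tilted_left (hgm : Measurable g) {K : ℝ} (hK : ∀ x, |g x| ≤ K) (n : ℕ)
    (t : ℝ) :
    (klDiv ((Measure.pi fun _ : Fin n => ν).tilted fun y => t * ∑ i, g (y i))
        (Measure.pi fun _ : Fin n => ν)).toReal
      = n * (t * deriv (cgf g ν) t - cgf g ν t) := by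
  have h : t ∈ interior (integrableExpSet (fun y : Fin n → X => ∑ i, g (y i))
      (Measure.pi fun _ : Fin n => ν)) := by
    rw [interior_integrableExpSet_pi_sum hgm hK n]; exact Set.mem_univ _
  rw [toReal_klDiv_tilted_mul_left h, cgf_pi_sum hgm, deriv_cgf_pi_sum hgm]
  ring

/-- **THE TRANSFER LOSS OF THE `n`-BLOCK SAMPLER** (flow trained at `s`, target at `t`):
`KL = n·(cgf_g(t) − cgf_g(s) − (t − s)·cgf_g′(s))`. [ours] -/
theorem toReal_klDiv_pi_tilted_tilted (hgm : Measurable g) {K : ℝ} (hK : ∀ x, |g x| ≤ K) (n : ℕ)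
    (s t : ℝ) :
    (klDiv ((Measure.pi fun _ : Fin n => ν).tilted fun y => s * ∑ i, g (y i))
        ((Measure.pi fun _ : Fin n => ν).tilted fun y => t * ∑ i, g (y i))).toReal
      = n * (cgf g ν t - cgf g ν s - (t - s) * deriv (cgf g ν) s) := by
  have hTm : Measurable (fun y : Fin n → X => ∑ i, g (y i)) :=
    Finset.measurable_sum _ fun i _ => hgm.comp (measurable_pi_apply i)
  have hs : s ∈ interior (integrableExpSet (fun y : Fin n → X => ∑ i, g (y i))
      (Measure.pi fun _ : Fin n => ν)) := by
    rw [interior_integrableExpSet_pi_sum hgm hK n]; exact Set.mem_univ _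
  have hexp : Integrable (fun y : Fin n → X => Real.exp (t * ∑ i, g (y i)))
      (Measure.pi fun _ : Fin n => ν) :=
    integrable_exp_mul_of_mem_Icc hTm.aemeasurable (pi_sum_mem_Icc hK n)
  rw [toReal_klDiv_tilted_mul_tilted_mul hs hexp, cgf_pi_sum hgm, cgf_pi_sum hgm,
    deriv_cgf_pi_sum hgm]
  ring

end Blocks

end Summit.Ventures.LatticeQCDFlow.Theory2

end
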